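import Summits.AnomalousDissipation.AnomalousDissipation.Theses.DecimationAxis
import Summits.AnomalousDissipation.AnomalousDissipation.Theses.MomentParity
import Literature.Analysis.FluidPDE.GalerkinFlow
import Literature.Analysis.FluidPDE.NSGalerkinTrajectory

/-!
# Stub-ideation k=1 (FAMILY 1 — recognise & import) for `stub_uniformGalerkinAnomaly`
# of crux `DecimationAxis.GalerkinFloor` (stmt-AnomalousDissipation-1582)

Elaboration sanity file for the helper-lemma SIGNATURES proposed in
`STUB-IDEAS-stub_uniformGalerkinAnomaly-1.md`.  Every `theorem` below is a PROPOSAL (body `sorry`);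
nothing here is registered or proved.  §0 copies the skeleton's transparent vocabulary verbatim
(`Cruxes/GalerkinFloor/Lines/birth.lean` §0) so that the signatures are character-compatible with the
registered stub.
-/

noncomputable section

set_option linter.dupNamespace false

open Filter Set MeasureTheory
open Literature.Analysis.FunctionSpaces Literature.Analysis.FunctionSpaces.Torus Literature.Analysis.FluidPDE

namespace Summit.AnomalousDissipation.AnomalousDissipation.Cruxes.GalerkinFloor.StubIdeas1

open Summit.AnomalousDissipation.AnomalousDissipation.Theses

/-- Lattice frequencies `ℤ³` (local notation). -/
local notation "ℤ³" => Fin 3 → ℤ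
/-- Fourier coefficient values `ℂ³` (local notation). -/
local notation "ℂ³" => EuclideanSpace ℂ (Fin 3)

/-! ## §0 Vocabulary of the skeleton (verbatim copy of `Lines/birth.lean` §0) -/

def IsDesignerForce (N : ℕ) (g : ℤ³ → ℂ³) : Prop :=
  IsConjSymm g ∧ (∀ k, k ∉ freqBall N → g k = 0) ∧ g 0 = 0 ∧
    (∀ k : ℤ³, ∑ i, ((k i : ℤ) : ℂ) * g k i = 0)

def IsCoeffTrajectory (S : Finset ℤ³) (ν : ℝ) (g : ℤ³ → ℂ³) (c : ℝ → ↥S → ℂ³) : Prop :=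
  (∀ t, c t ∈ galerkinSubspace S) ∧ ContinuousOn c (Set.Ici 0) ∧
    (∀ T : ℝ, ∀ t ∈ Set.Icc (0 : ℝ) T,
      HasDerivWithinAt c (galerkinRHS S ν (fun k => g k) (c t)) (Set.Icc 0 T) t)

def coeffEnergy {S : Finset ℤ³} (c : ℝ → ↥S → ℂ³) : ℝ → ℝ :=
  fun t => ∑ k : ↥S, ‖c t k‖ ^ 2

def coeffDissipation {S : Finset ℤ³} (ν : ℝ) (c : ℝ → ↥S → ℂ³) : ℝ → ℝ :=
  fun t => ν * (4 * Real.pi ^ 2 * ∑ k : ↥S, freqNormSq (k : ℤ³) * ‖c t k‖ ^ 2)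

/-- NEW (work currency): instantaneous injected power `W(t) = Σ_{k∈S} Re⟪g_k, c_k(t)⟫ = ∫⟪G, u(t)⟫`. -/
def coeffWork {S : Finset ℤ³} (g : ℤ³ → ℂ³) (c : ℝ → ↥S → ℂ³) : ℝ → ℝ :=
  fun t => ∑ k : ↥S, (inner ℂ (g k) (c t k)).re

/-- The registered stub `stub_uniformGalerkinAnomaly`, verbatim, as a `Prop` (for stating arrows). -/
def UniformGalerkinAnomaly : Prop :=
  ∃ (N : ℕ) (g : ℤ³ → ℂ³), IsDesignerForce N g ∧ ∃ (E ε : ℝ), 0 < ε ∧ ∃ ν : ℕ → ℝ,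
    (∀ j, 0 < ν j) ∧ Tendsto ν atTop (nhds 0) ∧
    ∀ j, ∃ K₀ : ℕ, ∀ K, K₀ ≤ K → ∀ S : Finset ℤ³, S = (freqBall K).erase 0 →
      ∃ c : ℝ → ↥S → ℂ³, IsCoeffTrajectory S (ν j) g c ∧
        longTimeAvgSup (coeffEnergy c) ≤ E ∧ ε ≤ longTimeAvgInf (coeffDissipation (ν j) c)

/-- **Injection persistence** — the stub in WORK currency: same witness pattern, the floor is on the
`liminf`-mean injected power instead of the `liminf`-mean total dissipation. -/
def InjectionPersistence : Prop :=
  ∃ (N : ℕ) (g : ℤ³ → ℂ³), IsDesignerForce N g ∧ ∃ (E ε : ℝ), 0 < ε ∧ ∃ ν : ℕ → ℝ,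
    (∀ j, 0 < ν j) ∧ Tendsto ν atTop (nhds 0) ∧
    ∀ j, ∃ K₀ : ℕ, ∀ K, K₀ ≤ K → ∀ S : Finset ℤ³, S = (freqBall K).erase 0 →
      ∃ c : ℝ → ↥S → ℂ³, IsCoeffTrajectory S (ν j) g c ∧
        longTimeAvgSup (coeffEnergy c) ≤ E ∧ ε ≤ longTimeAvgInf (coeffWork g c)

/-! ## Plan A — the long-time Galerkin energy balance (dictionary to work currency) -/

/-- H0 · the stub's solution notion IS the tree's `IsGalerkinODESolution` (datum `c 0`). -/
theorem isCoeffTrajectory_iff {S : Finset ℤ³} {ν : ℝ} {g : ℤ³ → ℂ³} {c : ℝ → ↥S → ℂ³} :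
    IsCoeffTrajectory S ν g c ↔ IsGalerkinODESolution ν (fun k : ↥S => g k) (c 0) c := by
  sorry

/-- H7 · uniform-in-time energy bound on the punctured ball (absorbing ball, Poincaré needs `0 ∉ S`):
`Σ‖c_k(t)‖² ≤ max (Σ‖c_k(0)‖²) (‖g‖²_{ℓ²}/(4π²ν)²)` for `t ≥ 0`. Port of `stub_absorbingBall`. -/
theorem coeffEnergy_le_max {K : ℕ} {S : Finset ℤ³} (hS : S = (freqBall K).erase 0) {ν : ℝ} (hν : 0 < ν)
    {N : ℕ} {g : ℤ³ → ℂ³} (hg : IsDesignerForce N g) {c : ℝ → ↥S → ℂ³} (hc : IsCoeffTrajectory S ν g c)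
    {t : ℝ} (ht : 0 ≤ t) :
    coeffEnergy c t ≤ max (coeffEnergy c 0) ((∑ k ∈ freqBall N, ‖g k‖ ^ 2) / (4 * Real.pi ^ 2 * ν) ^ 2) := by
  sorry

/-- H6a · finite-time energy balance: `⟨D⟩_T = ⟨W⟩_T + (E(0) − E(T))/(2T)` (integrate
`hasDerivWithinAt_energy`: `d/dt Σ‖c_k‖² = 2(−D + W)`). -/
theorem timeMean_coeffDissipation_eq {K : ℕ} {S : Finset ℤ³} (hS : S = (freqBall K).erase 0) {ν : ℝ}
    (hν : 0 ≤ ν) {N : ℕ} {g : ℤ³ → ℂ³} (hg : IsDesignerForce N g) {c : ℝ → ↥S → ℂ³}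
    (hc : IsCoeffTrajectory S ν g c) {T : ℝ} (hT : 0 < T) :
    timeMean (coeffDissipation ν c) T =
      timeMean (coeffWork g c) T + (coeffEnergy c 0 - coeffEnergy c T) / (2 * T) := by
  sorry

/-- H6 · long-time balance: mean total dissipation = mean injected power, in BOTH `liminf` and `limsup`
form (H6a + H7: the boundary term is `O(1/T)`). -/
theorem longTimeAvg_coeffDissipation_eq {K : ℕ} {S : Finset ℤ³} (hS : S = (freqBall K).erase 0) {ν : ℝ}
    (hν : 0 < ν) {N : ℕ} {g : ℤ³ → ℂ³} (hg : IsDesignerForce N g) {c : ℝ → ↥S → ℂ³}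
    (hc : IsCoeffTrajectory S ν g c) :
    longTimeAvgInf (coeffDissipation ν c) = longTimeAvgInf (coeffWork g c) ∧
      longTimeAvgSup (coeffDissipation ν c) = longTimeAvgSup (coeffWork g c) := by
  sorry

/-- H5 · trajectory energy row (Cauchy–Schwarz in `k`, Jensen in `t`): `⟨W⟩_T ≤ ‖g‖_{ℓ²} √⟨Σ‖c‖²⟩_T`. -/
theorem timeMean_coeffWork_le {K : ℕ} {S : Finset ℤ³} (hS : S = (freqBall K).erase 0) {ν : ℝ}
    {N : ℕ} {g : ℤ³ → ℂ³} (hg : IsDesignerForce N g) {c : ℝ → ↥S → ℂ³} (hc : IsCoeffTrajectory S ν g c)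
    {T : ℝ} (hT : 0 < T) :
    timeMean (coeffWork g c) T ≤
      Real.sqrt (∑ k ∈ freqBall N, ‖g k‖ ^ 2) * Real.sqrt (timeMean (coeffEnergy c) T) := by
  sorry

/-- A2 · the stub ⟺ injection persistence (termwise through H6). -/
theorem uniformGalerkinAnomaly_iff_injectionPersistence :
    UniformGalerkinAnomaly ↔ InjectionPersistence := by
  sorry

/-! ## Plan B — import UP: the stub implies the parked hub crux `MomentParity.GalerkinInvariantLoud` -/

/-- The force FIELD of a designer force: `G = realTrigPoly (freqBall N) g`. -/
def forceField (N : ℕ) (g : ℤ³ → ℂ³) : UnitAddTorus (Fin 3) → EuclideanSpace ℝ (Fin 3) :=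
  realTrigPoly (freqBall N) g

/-- H1a · the force field is smooth, divergence free, mean zero, and has Fourier coefficients `g`. -/
theorem forceField_spec {N : ℕ} {g : ℤ³ → ℂ³} (hg : IsDesignerForce N g) :
    IsSmooth (forceField N g) ∧ IsDivFree (forceField N g) ∧ HasZeroMean (forceField N g) ∧
      ∀ k : ℤ³, UnitAddTorus.mFourierCoeff
        (Literature.Analysis.FunctionSpaces.EuclideanSpace.complexify ∘ forceField N g) k = g k := by
  sorry

/-- H1 · coefficient ⇒ field dictionary with ZERO-MODE EXTENSION: a stub trajectory on the punctured ball
`(freqBall K).erase 0`, `K ≥ N`, is the tree's field-level Galerkin orbit `galerkinFlow ν G K · a` of the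
mean-zero Galerkin mode `a = realTrigPoly S (c 0)̄`, and the stub's two functionals are `‖u‖₂²` and
`ν‖∇u‖₂²` of the slices (uniqueness `IsGalerkinODESolution.eqOn`, `galerkinRHS_apply_eq_zero_of_coe_eq_zero`,
`kineticEnergy_realTrigPoly`, `toReal_eGradNormSq_realTrigPoly`). -/
theorem galerkinFlow_eq_of_isCoeffTrajectory {N K : ℕ} (hNK : N ≤ K) {S : Finset ℤ³}
    (hS : S = (freqBall K).erase 0) {ν : ℝ} (hν : 0 < ν) {g : ℤ³ → ℂ³} (hg : IsDesignerForce N g)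
    {c : ℝ → ↥S → ℂ³} (hc : IsCoeffTrajectory S ν g c) :
    IsGalerkinMode K (realTrigPoly S (coeffExt S (c 0))) ∧ HasZeroMean (realTrigPoly S (coeffExt S (c 0))) ∧
      ∀ t, 0 ≤ t →
        Torus.galerkinFlow ν (forceField N g) K t (realTrigPoly S (coeffExt S (c 0))) =
            realTrigPoly S (coeffExt S (c t)) ∧
          (∫ x, ‖realTrigPoly S (coeffExt S (c t)) x‖ ^ 2) = coeffEnergy c t ∧
          ν * (eGradNormSq (realTrigPoly S (coeffExt S (c t)))).toReal = coeffDissipation ν c t := by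
  sorry

/-- H8a · ZERO-MODE EXCISION: a full-ball Galerkin ODE solution with vanishing mean mode (it stays `0`:
`apply_zero_of_isGalerkinODESolution`) restricts to a stub trajectory on the punctured ball (the convolution
terms through `p = 0` / `q = 0` vanish on both sides; cf. `galerkinRHS_apply_eq_zero_of_coe_eq_zero`). -/
theorem isCoeffTrajectory_erase_of_isGalerkinODESolution {K : ℕ} {ν : ℝ} {N : ℕ} {g : ℤ³ → ℂ³}
    (hg : IsDesignerForce N g) {x : ↥(freqBall K) → ℂ³} {α : ℝ → ↥(freqBall K) → ℂ³}
    (hα : IsGalerkinODESolution ν (fun k : ↥(freqBall K) => g k) x α)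
    (hx0 : x ⟨0, zero_mem_freqBall K⟩ = 0) :
    IsCoeffTrajectory ((freqBall K).erase 0) ν g
      (fun t (k : ↥((freqBall K).erase 0)) => α t ⟨k.1, Finset.mem_of_mem_erase k.2⟩) := by
  sorry

/-- H8b · ZERO-MODE EXTENSION (converse of H8a): padding a stub trajectory by a zero mean mode gives the tree's
full-ball Galerkin ODE solution (hence, by uniqueness `IsGalerkinODESolution.eqOn`, the `galerkinCoeffFlow` /
`galerkinPhaseFlow` / `galerkinFlow` orbit). -/
theorem isGalerkinODESolution_pad_of_isCoeffTrajectory {K : ℕ} {ν : ℝ} {N : ℕ} {g : ℤ³ → ℂ³}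
    (hg : IsDesignerForce N g) {c : ℝ → ↥((freqBall K).erase 0) → ℂ³}
    (hc : IsCoeffTrajectory ((freqBall K).erase 0) ν g c) :
    IsGalerkinODESolution ν (fun k : ↥(freqBall K) => g k)
      (fun k : ↥(freqBall K) => coeffExt ((freqBall K).erase 0) (c 0) k.1)
      (fun t (k : ↥(freqBall K)) => coeffExt ((freqBall K).erase 0) (c t) k.1) := by
  sorry

/-- B1 · **the stub implies the one-trajectory Taylor statement** (`stub_oneTrajectoryTaylor` of
`Cruxes/GalerkinInvariantLoud/Lines/taylor_cone_homogenisation.lean`, verbatim) with `f := forceField N g`,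
`κ := ε/E`: window ⟹ cone (`liminf`/`limsup` are eventual bounds), `∀ᶠ K ⟹ ∃ᶠ N`, H1 for the dictionary,
H6a for `f ≠ 0` and `E > 0`. -/
theorem oneTrajectoryTaylor_of_uniformGalerkinAnomaly : UniformGalerkinAnomaly →
    ∃ f : UnitAddTorus (Fin 3) → EuclideanSpace ℝ (Fin 3),
      IsSmooth f ∧ IsDivFree f ∧ HasZeroMean f ∧ f ≠ 0 ∧
      ∃ (ν : ℕ → ℝ) (κ : ℝ), (∀ j, 0 < ν j) ∧ Tendsto ν atTop (nhds 0) ∧ 0 < κ ∧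
        ∀ j : ℕ, ∃ᶠ N in atTop, ∃ a : UnitAddTorus (Fin 3) → EuclideanSpace ℝ (Fin 3),
          IsGalerkinMode N a ∧ HasZeroMean a ∧
          κ ≤ Filter.liminf (fun T : ℝ =>
            (ν j * (∫⁻ t in Ioo 0 T, eGradNormSq (Torus.galerkinFlow (ν j) f N t a)).toReal) /
              (∫ t in (0 : ℝ)..T, ∫ x, ‖Torus.galerkinFlow (ν j) f N t a x‖ ^ 2)) atTop := by
  sorry

/-- B2 · **the stub implies the parked crux stmt-AnomalousDissipation-14283** (B1 composed with the landed
S1–S3 of line `taylor`: `stub_taylorReduction stub_energyFloor (… stub_krylovBogoliubov …)`, the body of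
`TaylorConeHomogenisation.GalerkinInvariantLoud_of`).  Corollaries by contraposition with landed arrows:
`¬GalerkinInvariantLoud → ¬stub`, `¬W → ¬stub` (`not_galerkinInvariantLoud_of_not_workLaw`),
`¬QuarticGate → ¬stub` (`not_galerkinInvariantLoud_of_not_quarticGate`). -/
theorem galerkinInvariantLoud_of_uniformGalerkinAnomaly :
    UniformGalerkinAnomaly → MomentParity.GalerkinInvariantLoud := by
  sorry

/-! ## Plan C — import DOWN: the EVENTUALLY-`N`, band-limited-force form of 14283 gives the stub -/

/-- `GalerkinInvariantLoud` (stmt-14283) with two typed changes: the force is BAND-LIMITED (a Galerkin mode of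
some order `N₀`) and the level clause is EVENTUAL (`∀ᶠ N`) instead of frequent (`∃ᶠ N`).  Claimed: this is the
exact law-currency twin of the stub (C3 below and Plan B give both arrows). -/
def GalerkinInvariantLoudEventually : Prop :=
  ∃ f : UnitAddTorus (Fin 3) → EuclideanSpace ℝ (Fin 3), Literature.Analysis.FunctionSpaces.Torus.IsSmooth f ∧ Literature.Analysis.FunctionSpaces.Torus.IsDivFree f ∧ Literature.Analysis.FunctionSpaces.Torus.HasZeroMean f ∧ (∃ N₀ : ℕ, ∀ k ∉ Literature.Analysis.FunctionSpaces.Torus.freqBall N₀, UnitAddTorus.mFourierCoeff (Literature.Analysis.FunctionSpaces.EuclideanSpace.complexify ∘ f) k = 0) ∧ ∃ (ν : ℕ → ℝ) (E ε : ℝ), (∀ j, 0 < ν j) ∧ Filter.Tendsto ν Filter.atTop (nhds 0) ∧ 0 < ε ∧ ∀ j : ℕ, ∃ R : ℝ, ∀ᶠ N in Filter.atTop, ∃ μ : MeasureTheory.Measure (Literature.Analysis.FunctionSpaces.Torus.energySpace (Fin 3)), MeasureTheory.IsProbabilityMeasure μ ∧ (∀ᵐ (u : Literature.Analysis.FunctionSpaces.Torus.energySpace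 (Fin 3)) ∂μ, (∀ k ∉ (Literature.Analysis.FunctionSpaces.Torus.freqBall N).erase (0 : Fin 3 → ℤ), UnitAddTorus.mFourierCoeff (Literature.Analysis.FunctionSpaces.EuclideanSpace.complexify ∘ (u.1 : UnitAddTorus (Fin 3) → EuclideanSpace ℝ (Fin 3))) k = 0)) ∧ (∀ᵐ u ∂μ, ‖u‖ ≤ R) ∧ (∀ (m : ℕ) (g : Fin m → UnitAddTorus (Fin 3) → EuclideanSpace ℝ (Fin 3)) (P : MvPolynomial (Fin m) ℝ), (∀ i, (Literature.Analysis.FunctionSpaces.Torus.IsSmooth (g i) ∧ Literature.Analysis.FunctionSpaces.Torus.IsDivFree (g i) ∧ Literature.Analysis.FunctionSpaces.Torus.HasZeroMean (g i) ∧ (∀ k ∉ (Literature.Analysis.FunctionSpaces.Torus.freqBall N).erase (0 : Fin 3 → ℤ), UnitAddTorus.mFourierCoeff (Literature.Analysis.FunctionSpaces.EuclideanSpace.complexify ∘ (g i)) k = 0))) → MeasureTheory.Integrable (fun u => Literature.Analysis.FluidPDE.Torus.nsGeneratorPairing (ν j) f u (fun x => ∑ i : Fin m, (MvPolynomial.eval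 (fun j => Literature.Analysis.FluidPDE.Torus.pairing u.1 (g j)) (MvPolynomial.pderiv i P)) • g i x)) μ ∧ ∫ u, Literature.Analysis.FluidPDE.Torus.nsGeneratorPairing (ν j) f u (fun x => ∑ i : Fin m, (MvPolynomial.eval (fun j => Literature.Analysis.FluidPDE.Torus.pairing u.1 (g j)) (MvPolynomial.pderiv i P)) • g i x) ∂μ = 0) ∧ Literature.Analysis.FluidPDE.Torus.ensembleEnergy μ ≤ E ∧ ε ≤ Literature.Analysis.FluidPDE.Torus.ensembleDissipation (ν j) μ

/-- C0 · sanity: the eventual band-limited form is at least the hub crux (`Eventually.frequently`, drop a clause). -/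
theorem galerkinInvariantLoud_of_eventually :
    GalerkinInvariantLoudEventually → MomentParity.GalerkinInvariantLoud := by
  sorry

/-- H4 · **one-functional Birkhoff selection** (abstract ergodic lemma): for a measurable semiflow preserving a
probability law and countably many bounded observables, SOME point is generic for all of them (time means
converge) and, for the distinguished observable `F i₀`, the time mean is at least the space mean
(`∫ F* dμ = ∫ F dμ`, `birkhoff_ergodic_theorem_holds` for the time-1 map + the integer→real-time step of
`MomentParityMomentLadderOneTrajectoryConverse` §A).  Used with `F i₀ := D − (ε/2E)·En`, `F i₁ := En`, `F i₂ := D`. -/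
theorem exists_generic_point_timeMean_ge {X : Type*} [MeasurableSpace X] {μ : Measure X}
    [IsProbabilityMeasure μ] (φ : ℝ → X → X) (hφm : Measurable fun p : ℝ × X => φ p.1 p.2)
    (hφ : ∀ s t : ℝ, 0 ≤ s → 0 ≤ t → ∀ x, φ (s + t) x = φ s (φ t x))
    (hinv : ∀ t, 0 ≤ t → MeasurePreserving (φ t) μ μ)
    {ι : Type*} [Countable ι] (F : ι → X → ℝ) (hFm : ∀ i, Measurable (F i))
    (hFb : ∀ i, ∃ C, ∀ x, |F i x| ≤ C) (i₀ : ι) :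
    ∃ x : X, (∀ i, ∃ l : ℝ, Tendsto (fun T => timeMean (fun t => F i (φ t x)) T) atTop (nhds l)) ∧
      ∫ y, F i₀ y ∂μ ≤ longTimeAvgInf (fun t => F i₀ (φ t x)) := by
  sorry

/-- C3 · **the eventual band-limited law form implies the stub**: rows ⟹ flow-invariant phase law
(`MomentParityMomentLadder…PhaseLaw`), H4 with `Ψ = D − (ε/2E)En` ⟹ ONE datum with limit means
`⟨D⟩ ≥ ε/2 + (ε/2E)⟨En⟩ ≥ ε/2`, H5 + H6 ⟹ `⟨En⟩ ≤ E'(‖g‖, E, ε)` uniformly in `(j, K)`, H1/H0 backwards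
(`isGalerkinTrajectory_coeff` + zero-mode excision `galerkinRHS_apply_eq_zero_of_coe_eq_zero`) for the
coefficient trajectory on the punctured ball; `g := f̂`. -/
theorem uniformGalerkinAnomaly_of_galerkinInvariantLoudEventually :
    GalerkinInvariantLoudEventually → UniformGalerkinAnomaly := by
  sorry

/-! ## Corners (cheap dedup edges to two other hub items) -/

/-- D1 · steady corner: eventually-in-`K` loud bounded STEADY Galerkin states (coefficient form of
`MirrorVariety.GalerkinSteadyZerothLaw` stmt-2986, but `∀ᶠ K` and designer force) give the stub by constant
trajectories (time means = pointwise values). -/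
theorem uniformGalerkinAnomaly_of_steadyEventually
    (h : ∃ (N : ℕ) (g : ℤ³ → ℂ³), IsDesignerForce N g ∧ ∃ (E ε : ℝ), 0 < ε ∧ ∃ ν : ℕ → ℝ,
      (∀ j, 0 < ν j) ∧ Tendsto ν atTop (nhds 0) ∧
      ∀ j, ∀ᶠ K in atTop, ∀ S : Finset ℤ³, S = (freqBall K).erase 0 →
        ∃ c₀ : ↥S → ℂ³, c₀ ∈ galerkinSubspace S ∧ galerkinRHS S (ν j) (fun k => g k) c₀ = 0 ∧
          ∑ k : ↥S, ‖c₀ k‖ ^ 2 ≤ E ∧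
          ε ≤ ν j * (4 * Real.pi ^ 2 * ∑ k : ↥S, freqNormSq (k : ℤ³) * ‖c₀ k‖ ^ 2)) :
    UniformGalerkinAnomaly := by
  sorry

/-- D2 · Ważewski corner: the MEAN-ZERO reading of `WazewskiBlock.UniformWorkFloorTrap` (stmt-10353: pointwise
window `KE ≤ E`, `(f, U) ≥ ε₀` for EVERY `N ≥ N₀(ν)`, field side, clause block = `Torus.IsGalerkinTrajectory` by
`Torus.isGalerkinTrajectory_iff`) gives the stub: `ν_j := ν₀/(j+1)`, `g := f̂`, `isGalerkinTrajectory_coeff`,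
zero-mode excision, pointwise ⟹ time means, H6.  As TYPED, 10353 lacks `HasZeroMean (U 0)` (Galilean drift of
the conserved mean mode changes the punctured-ball system) — flagged, not repaired here. -/
theorem uniformGalerkinAnomaly_of_workFloorTrap_meanZero
    (h : ∃ (m : ℕ) (f : UnitAddTorus (Fin 3) → EuclideanSpace ℝ (Fin 3)), IsGalerkinMode m f ∧ HasZeroMean f ∧
      ∃ (E ε₀ ν₀ : ℝ), 0 < ε₀ ∧ 0 < ν₀ ∧ ∀ ν : ℝ, 0 < ν → ν ≤ ν₀ → ∃ N₀ : ℕ, ∀ N : ℕ, N₀ ≤ N →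
        ∃ U : ℝ → UnitAddTorus (Fin 3) → EuclideanSpace ℝ (Fin 3), Torus.IsGalerkinTrajectory ν f N U ∧
          HasZeroMean (U 0) ∧ ∀ t : ℝ, 0 ≤ t → kineticEnergy (U t) ≤ E ∧ ε₀ ≤ ∫ x, inner ℝ (f x) (U t x)) :
    UniformGalerkinAnomaly := by
  sorry

end Summit.AnomalousDissipation.AnomalousDissipation.Cruxes.GalerkinFloor.StubIdeas1

end
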